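/-
Copyright: statement-level skeleton of a published paper (lit-balaban cell, Phase-2 proof seat p25, gen 18). No proof
claims beyond what the kernel checks below.
-/
import Literature.MathematicalPhysics.QuantumFieldTheory.BalabanImbrieJaffe1984to88.BIJ88WalkGeometry311
import Literature.MathematicalPhysics.QuantumFieldTheory.BalabanImbrieJaffe1984to88.BIJ88WalkWeights312

/-!
# `BalabanImbrieJaffe1984to88.BIJ88WalkActivityShape312` — T. Bałaban, J. Imbrie, A. Jaffe, *Effective action and
cluster properties of the abelian Higgs model*, Commun. Math. Phys. **114** (1988) 257–315 [BalabanImbrieJaffe1988],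
§5.14 p. 312 [PDF 56], verbatim: *"These considerations lead to the following estimate:
|G_k(X)| ≤ c(F(X)) (e^β(L^kε/ε₀)^{1/4−α})^{β′|X∖∪X_c|} Π_{X_{σ₁}⊂X: …}[c(L^kε)^{−m(c)}e^{−m′(c)}]"* and *"By performing
sufficiently many integrations by parts, we have arranged for enough small factors to beat these large factors"* —
**THE WEIGHT OF A COMPONENT IN THE PRINTED CURRENCY: A LARGE CONSTANT PER OBSERVABLE IT CONTAINS TIMES A SMALL FACTOR
PER CUBE OF `X` NOT COVERED BY ITS OBSERVABLES** (p25 gen 18, on the expansion with the covariance split).  When the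
local piece has brackets `≤ B_ℓ` (LARGE, `B_ℓ ≥ 1`) and no region, a random-walk piece has brackets `≤ θ^{#reg p}` (a
small factor per cube of its region), and a vertex of arity `a` localized in `vc m` has coupling `cV m · B_ℓ^{a} ≤ θ^{#vc m}`
(a small factor per cube of its localization, after paying for the large brackets of its legs), then for every tidy
component `X` (every contraction consumed a leg — `BIJ88WalkWeights312.Tidy`):
`wt X ≤ (Π_{j ∈ X.lab} B_ℓ^{|obs j|}) · θ^{#(cubes X ∖ ⋃_{j ∈ X.lab} oc j)}` (`wt_le_shape`) — exactly the shape of the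
observable-activity hypothesis `hobs` of the polymer-gas side `BIJ88Ineq312Instance.norm_Gk_le_printed`
(`‖wQ X‖ ≤ (Π_{j∈H(X)} c_j) · θ^{β′ #(X ∖ slot cubes)}`), here with `β′ = 1`, `c_j = B_ℓ^{|obs j|}`.  With
`BIJ88WalkWeights312.expand_weight`: every term of the integration by parts of a product of observables has
`|coef_t|·Π‖dirs_t‖ ≤ Π_{X ∈ blocks ∪ remainder components of t} (Π_{j∈X.lab} c_j) θ^{#(cubes X ∖ obs cubes)}`
(`expand_shape_init`).

statement-level skeleton of published theorems with citation tags; proofs where landed; nothing here is a claim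
about the Yang–Mills mass gap

PDF held: `paper:balaban1988-cmp114-bij-abelian-higgs-effective-action` (journal page = PDF page + 256); p. 311–312 =
PDF 55–56 (`p0055.txt` L23–38, `p0056.txt` L1–25 re-read this session, 2026-08-22).

CITATION HEADER (lean-in-tree rule).  lit-balaban cell (HOME `run/shared/lean/pub/lit-balaban/`), Phase 2, seat p25
gen 18; row **C2.Claim@312** of `HOME/lit-balaban-r16/ROWS-C2-part2.md` (owner r16, referee ref-5; head
`BIJ88Sect5StatementsPart4.Ineq312` untouched — this file puts the TERMS of the integration by parts in the currency of
its hypothesis `hobs`; the SUM over the terms with a given family of components, the analytic factor and the cluster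
expansion of `⟨Π F_{k,rem}(X_r)⟩` remain).  USED BY NAME, nothing restated: `BIJ88WalkRun311.{WGrp, WOut, run,
pristine}`, `BIJ88WalkRunEnv311.{run_rest_subset, run_done_le}`, `BIJ88WalkGeometry311.{cubes, mem_cubes}`,
`BIJ88WalkExpansion311.{WTerm, expand, …}`, `BIJ88WalkWeights312.{LabDisj, labDisj_pristine, run_labDisj, budget, Tidy,
tidy_pristine, run_tidy, wt, expand_weight_init}` (this seat and generation), `BIJ88LabelledRun311.mem_mbind`.

## What is proved (0 `sorry`, standard axioms, no new `Prop` facts; definitions with bodies: `EnvOK`, `shape`)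

* §1 `card_msup_le`, **`card_cubes_sdiff_le`** (`#(cubes X ∖ obs cubes) ≤ Σ_{m ∈ X.vxs} #vc m + Σ_{p ∈ X.pcs} #reg p`).
* §2 `prod_map_pow_eq`, `prod_map_le_pow_card`, **`wt_le_shape`** (displayed above).
* §3 `EnvOK` (set-aside components: labels disjoint from the environment and from each other, tidy),
  **`expand_tidy`** (every block and remainder component of every term is tidy), `shape`, **`expand_shape`** /
  **`expand_shape_init`** (the weight of every term in the printed currency, component by component).
HONEST SCOPE: (a) PER TERM: the number of terms with a given family of components (print's "standard exercise",
locality of `C_loc` and convergence of the random-walk expansion) is NOT counted, so no activity `F_{k,rem}(X_r)` is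
bounded here; (b) the analytic factor `∫Π_{legs of X_r}Φ·(Π∂_{z/‖z‖})χe^{−V}dμ` and its shell small factors (gen 15–17
files) are not touched; (c) `B_ℓ`, `θ`, `cV`, `oc`, `vc`, `reg` are data with the displayed hypotheses — print's
`c(L^kε)^{−m(c)}e^{−m′(c)}` and `e^β(L^kε/ε₀)^{1/4−α}` are not derived; (d) contraction-graph components; (e) no binder
of `Ineq312` is instantiated.  NOT summit progress; NOT continuum; NOT Clay.  Imports `BIJ88WalkGeometry311`,
`BIJ88WalkWeights312`; modifies nothing.
-/

noncomputable section

namespace Literature.MathematicalPhysics.QuantumFieldTheory.BalabanImbrieJaffe1984to88.BIJ88WalkActivityShape312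

open Classical Matrix Finset
open scoped BigOperators
open BIJ88LabelledRun311 (mbind mem_mbind)
open BIJ88WalkRun311 BIJ88WalkRunEnv311 BIJ88WalkGeometry311 BIJ88WalkExpansion311 BIJ88WalkWeights312

variable {S : Type} [Fintype S] {ι : Type} [Fintype ι] {κ : Type} [LinearOrder κ] {P : Type} [Fintype P]
  {β : Type} [DecidableEq β]

/-! ## §1  Counting the cubes of `X` not covered by the observables -/

omit [LinearOrder κ] in
/-- The union over a multiset has at most the sum of the cardinalities (bookkeeping). [folklore] -/
private theorem card_msup_le {α : Type} (m : Multiset α) (F : α → Finset β) :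
    ((m.map F).sup).card ≤ (m.map fun a => (F a).card).sum := by
  induction m using Multiset.induction_on with
  | empty => simp
  | cons a m ih =>
    simp only [Multiset.map_cons, Multiset.sup_cons, Multiset.sum_cons, Finset.sup_eq_union]
    exact (Finset.card_union_le _ _).trans (Nat.add_le_add_left ih _)

omit [Fintype S] [Fintype ι] [LinearOrder κ] [Fintype P] in
/-- **The cubes of `X` not covered by its observables are covered by the vertex localizations and the walk regions**:
`#(cubes X ∖ ⋃_{j∈X.lab} oc j) ≤ Σ_{m ∈ X.vxs} #vc m + Σ_{p ∈ X.pcs} #reg p` (print's `|X ∖ ∪X_c|`-type count of the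
cubes that must carry small factors). [cite: BalabanImbrieJaffe1988, §5.14 p.312] -/
theorem card_cubes_sdiff_le (oc : κ → Finset β) (vc : ι → Finset β) (reg : P → Finset β) (g : WGrp S κ ι P) :
    (cubes oc vc reg g \ g.lab.biUnion oc).card
      ≤ (g.vxs.map fun m => (vc m).card).sum + (g.pcs.map fun p => (reg p).card).sum := by
  have hsub : cubes oc vc reg g \ g.lab.biUnion oc ⊆ (g.vxs.map vc).sup ∪ (g.pcs.map reg).sup := by
    intro x hx
    rw [Finset.mem_sdiff] at hx
    have h := hx.1
    simp only [cubes, Finset.mem_union] at h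
    rcases h with (h | h) | h
    · exact absurd h hx.2
    · exact Finset.mem_union_left _ h
    · exact Finset.mem_union_right _ h
  exact (Finset.card_le_card hsub).trans ((Finset.card_union_le _ _).trans
    (Nat.add_le_add (card_msup_le _ _) (card_msup_le _ _)))

/-! ## §2  The weight of a tidy component in the printed currency -/

omit [LinearOrder κ] [DecidableEq β] in
/-- `Π_{a ∈ m} θ^{n a} = θ^{Σ_{a ∈ m} n a}` (bookkeeping). [folklore] -/
private theorem prod_map_pow_eq {α : Type} (m : Multiset α) (θ : ℝ) (n : α → ℕ) :
    (m.map fun a => θ ^ n a).prod = θ ^ (m.map n).sum := by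
  induction m using Multiset.induction_on with
  | empty => simp
  | cons a m ih => simp only [Multiset.map_cons, Multiset.prod_cons, Multiset.sum_cons, ih, pow_add]

omit [LinearOrder κ] [DecidableEq β] in
/-- `Π_{a ∈ m} f a ≤ B^{#m}` when `0 ≤ f ≤ B` on `m` (bookkeeping). [folklore] -/
private theorem prod_map_le_pow_card {α : Type} (m : Multiset α) {f : α → ℝ} {B : ℝ} (h0 : ∀ a ∈ m, 0 ≤ f a)
    (h : ∀ a ∈ m, f a ≤ B) : (m.map f).prod ≤ B ^ Multiset.card m := by
  have h1 := Multiset.prod_map_le_prod_map₀ f (fun _ => B) h0 h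
  rwa [Multiset.map_const', Multiset.prod_replicate] at h1

omit [LinearOrder κ] [DecidableEq β] in
/-- A sum of zeros over a multiset vanishes (bookkeeping). [folklore] -/
private theorem sum_map_eq_zero {α : Type} (m : Multiset α) {n : α → ℕ} (h : ∀ a ∈ m, n a = 0) : (m.map n).sum = 0 := by
  rw [Multiset.sum_eq_zero]
  intro x hx
  obtain ⟨a, ha, rfl⟩ := Multiset.mem_map.1 hx
  exact h a ha

omit [Fintype S] [Fintype ι] [LinearOrder κ] [Fintype P] in
/-- **THE WEIGHT OF A TIDY COMPONENT IN THE PRINTED CURRENCY** (p. 312): local brackets `≤ B_ℓ` (`B_ℓ ≥ 1`, no region),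
random-walk brackets `≤ θ^{#reg p}`, vertices `cV m · B_ℓ^{|legs m|} ≤ θ^{#vc m}`, `0 < θ ≤ 1`; then
`wt X ≤ (Π_{j ∈ X.lab} B_ℓ^{|obs j|}) · θ^{#(cubes X ∖ ⋃_{j∈X.lab} oc j)}` — a large constant per observable of `X`
(its `#legs` brackets: *"we only have bounds |F_{k,loc}(X_{σ₁})| ≤ c(L^kε)^{−m(c)}…"*) times a small factor per cube
of `X` not covered by the observables (*"enough small factors to beat these large factors"*).
[cite: BalabanImbrieJaffe1988, §5.14 p.312] -/
theorem wt_le_shape {trig : P → Bool} {obs : κ → List (S → ℝ)} {legs : ι → List (S → ℝ)} {oc : κ → Finset β}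
    {vc : ι → Finset β} {reg : P → Finset β} {B : P → ℝ} {cV : ι → ℝ} {Bl θ : ℝ} (hθ0 : 0 < θ) (hθ1 : θ ≤ 1)
    (hBl : 1 ≤ Bl) (hB0 : ∀ p, 0 ≤ B p) (hcV0 : ∀ m, 0 ≤ cV m)
    (hloc : ∀ p, trig p = false → B p ≤ Bl ∧ reg p = ∅) (hwalk : ∀ p, trig p = true → B p ≤ θ ^ (reg p).card)
    (hvert : ∀ m, cV m * Bl ^ (legs m).length ≤ θ ^ (vc m).card) (g : WGrp S κ ι P) (hg : Tidy obs legs g) :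
    wt B cV g ≤ (∏ j ∈ g.lab, Bl ^ (obs j).length) * θ ^ (cubes oc vc reg g \ g.lab.biUnion oc).card := by
  have hBl0 : 0 ≤ Bl := zero_le_one.trans hBl
  -- split the pieces into local and random-walk ones
  set Lc := g.pcs.filter fun p => trig p = false with hLc
  set Wk := g.pcs.filter fun p => ¬ trig p = false with hWk
  have hsplit : g.pcs = Lc + Wk := (Multiset.filter_add_not _ g.pcs).symm
  have hWk : ∀ p ∈ Wk, trig p = true := fun p hp => by
    have h := (Multiset.mem_filter.1 hp).2
    cases htr : trig p
    · exact absurd htr h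
    · rfl
  have hLcm : ∀ p ∈ Lc, trig p = false := fun p hp => (Multiset.mem_filter.1 hp).2
  -- (i) local brackets: at most `Bl^{#pcs} ≤ Bl^{budget}`
  have hPL : (Lc.map B).prod ≤ Bl ^ budget obs legs g := by
    refine (prod_map_le_pow_card Lc (fun p _ => hB0 p) fun p hp => (hloc p (hLcm p hp)).1).trans ?_
    refine pow_le_pow_right₀ hBl ((Multiset.card_le_card (Multiset.filter_le _ _)).trans (card_pcs_le_budget hg))
  -- (ii) random-walk brackets: a small factor per cube of the regions
  have hPW : (Wk.map B).prod ≤ θ ^ (g.pcs.map fun p => (reg p).card).sum := by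
    have h1 : (Wk.map B).prod ≤ (Wk.map fun p => θ ^ (reg p).card).prod :=
      Multiset.prod_map_le_prod_map₀ _ _ (fun p _ => hB0 p) fun p hp => hwalk p (hWk p hp)
    rw [prod_map_pow_eq] at h1
    have h2 : (g.pcs.map fun p => (reg p).card).sum = (Wk.map fun p => (reg p).card).sum := by
      rw [hsplit, Multiset.map_add, Multiset.sum_add, sum_map_eq_zero Lc fun p hp => by
        rw [(hloc p (hLcm p hp)).2, Finset.card_empty], zero_add]
    rwa [h2]
  -- (iii) vertices: after paying for their legs' brackets, a small factor per cube of their localizations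
  have hPV : (g.vxs.map cV).prod * Bl ^ (g.vxs.map fun m => (legs m).length).sum
      ≤ θ ^ (g.vxs.map fun m => (vc m).card).sum := by
    rw [← prod_map_pow_eq g.vxs Bl, ← Multiset.prod_map_mul, ← prod_map_pow_eq]
    exact Multiset.prod_map_le_prod_map₀ _ _ (fun m _ => mul_nonneg (hcV0 m) (pow_nonneg hBl0 _)) fun m _ => hvert m
  -- assemble
  have hPL0 : 0 ≤ (Lc.map B).prod :=
    Multiset.prod_nonneg fun x hx => by obtain ⟨p, -, rfl⟩ := Multiset.mem_map.1 hx; exact hB0 p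
  have hPW0 : 0 ≤ (Wk.map B).prod :=
    Multiset.prod_nonneg fun x hx => by obtain ⟨p, -, rfl⟩ := Multiset.mem_map.1 hx; exact hB0 p
  have hPV0 : 0 ≤ (g.vxs.map cV).prod :=
    Multiset.prod_nonneg fun x hx => by obtain ⟨m, -, rfl⟩ := Multiset.mem_map.1 hx; exact hcV0 m
  have hexp : (cubes oc vc reg g \ g.lab.biUnion oc).card
      ≤ (g.vxs.map fun m => (vc m).card).sum + (g.pcs.map fun p => (reg p).card).sum := card_cubes_sdiff_le oc vc reg g
  calc wt B cV g = (Lc.map B).prod * (Wk.map B).prod * (g.vxs.map cV).prod := by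
        rw [wt, hsplit, Multiset.map_add, Multiset.prod_add]
    _ ≤ Bl ^ budget obs legs g * (Wk.map B).prod * (g.vxs.map cV).prod :=
        mul_le_mul_of_nonneg_right (mul_le_mul_of_nonneg_right hPL hPW0) hPV0
    _ = Bl ^ (∑ j ∈ g.lab, (obs j).length) *
          (((g.vxs.map cV).prod * Bl ^ (g.vxs.map fun m => (legs m).length).sum) * (Wk.map B).prod) := by
        rw [budget, pow_add]; ring
    _ ≤ Bl ^ (∑ j ∈ g.lab, (obs j).length) *
          (θ ^ (g.vxs.map fun m => (vc m).card).sum * θ ^ (g.pcs.map fun p => (reg p).card).sum) :=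
        mul_le_mul_of_nonneg_left (mul_le_mul hPV hPW hPW0 (pow_nonneg hθ0.le _)) (pow_nonneg hBl0 _)
    _ = Bl ^ (∑ j ∈ g.lab, (obs j).length) *
          θ ^ ((g.vxs.map fun m => (vc m).card).sum + (g.pcs.map fun p => (reg p).card).sum) := by rw [pow_add]
    _ ≤ Bl ^ (∑ j ∈ g.lab, (obs j).length) * θ ^ (cubes oc vc reg g \ g.lab.biUnion oc).card :=
        mul_le_mul_of_nonneg_left (pow_le_pow_of_le_one hθ0.le hθ1 hexp) (pow_nonneg hBl0 _)
    _ = (∏ j ∈ g.lab, Bl ^ (obs j).length) * θ ^ (cubes oc vc reg g \ g.lab.biUnion oc).card := by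
        rw [Finset.prod_pow_eq_pow_sum]

/-! ## §3  Every component of every term is tidy; the weight of a term in the printed currency -/

section Expand

variable {Cov : P → Matrix S S ℝ} {trig : P → Bool} {f : S → ℝ} {c : ι → ℝ} {legs : ι → List (S → ℝ)}
  {obs : κ → List (S → ℝ)} {M : ℕ}

/-- **A consistent environment**: the complete components set aside have labels disjoint from the untouched
observables and from each other, and are tidy. [cite: BalabanImbrieJaffe1988, §5.14 p.311] -/
def EnvOK (obs : κ → List (S → ℝ)) (legs : ι → List (S → ℝ)) (rest : Finset κ) (done : Multiset (WGrp S κ ι P)) :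
    Prop :=
  (∀ h ∈ done, Disjoint h.lab rest) ∧ (∀ h₁ ∈ done, ∀ h₂ ∈ done.erase h₁, Disjoint h₁.lab h₂.lab)
    ∧ ∀ h ∈ done, Tidy obs legs h

omit [Fintype S] [Fintype ι] [LinearOrder κ] [Fintype P] in
/-- Nothing set aside is a consistent environment. [cite: BalabanImbrieJaffe1988, §5.14 p.311] -/
theorem envOK_zero (rest : Finset κ) : EnvOK (S := S) (ι := ι) (P := P) obs legs rest 0 :=
  ⟨fun _ hh => absurd hh (Multiset.notMem_zero _), fun _ hh => absurd hh (Multiset.notMem_zero _),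
    fun _ hh => absurd hh (Multiset.notMem_zero _)⟩

omit [Fintype S] [Fintype ι] [LinearOrder κ] [Fintype P] in
/-- After a run from a consistent environment, the outcome's component set aside with the outcome's environment is
again consistent (bookkeeping from `LabDisj`). [cite: BalabanImbrieJaffe1988, §5.14 p.311] -/
private theorem envOK_cons {o : WOut S κ ι P} (hL : LabDisj o.g o.rest o.done) (hT : Tidy obs legs o.g)
    (hTd : ∀ h ∈ o.done, Tidy obs legs h) : EnvOK obs legs o.rest (o.g ::ₘ o.done) := by
  refine ⟨fun h hh => ?_, fun h₁ hh₁ h₂ hh₂ => ?_, fun h hh => ?_⟩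
  · rcases Multiset.mem_cons.1 hh with rfl | hh
    · exact hL.1
    · exact (hL.2.1 h hh).2
  · rcases Multiset.mem_cons.1 hh₁ with rfl | hh₁
    · rw [Multiset.erase_cons_head] at hh₂
      exact (hL.2.1 h₂ hh₂).1
    · rw [Multiset.erase_cons_tail_of_mem hh₁] at hh₂
      rcases Multiset.mem_cons.1 hh₂ with rfl | hh₂
      · exact (hL.2.1 h₁ hh₁).1.symm
      · exact hL.2.2 h₁ hh₁ h₂ hh₂
  · rcases Multiset.mem_cons.1 hh with rfl | hh
    · exact hT
    · exact hTd h hh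

/-- **EVERY BLOCK AND EVERY REMAINDER COMPONENT OF EVERY TERM IS TIDY** (labels disjoint along the expansion, every
contraction consumed a pending leg). [cite: BalabanImbrieJaffe1988, §5.14 p.311–312] -/
theorem expand_tidy : ∀ (n : ℕ) (done : Multiset (WGrp S κ ι P)) (rest : Finset κ), rest.card < n →
    EnvOK obs legs rest done → ∀ t ∈ expand Cov trig f c legs obs M done rest,
      (∀ g ∈ t.consts, Tidy obs legs g) ∧ ∀ g ∈ t.groups, Tidy obs legs g
  | 0, _, _, hn => fun _ _ _ => absurd hn (Nat.not_lt_zero _)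
  | n + 1, done, rest, hn => by
    intro hE t ht
    by_cases h : rest.Nonempty
    · rw [expand_of_nonempty Cov trig f c legs obs M h, mem_mbind] at ht
      obtain ⟨o, ho, ht⟩ := ht
      have hcard : o.rest.card < n := lt_of_lt_of_le (lt_of_le_of_lt (Finset.card_le_card (run_rest_subset _ _ _ o ho))
        (Finset.card_erase_lt_of_mem (rest.min'_mem h))) (Nat.lt_succ_iff.1 hn)
      have hL0 : LabDisj (pristine (ι := ι) (P := P) obs (rest.min' h)) (rest.erase (rest.min' h)) done :=
        labDisj_pristine hE.1 hE.2.1 (rest.min'_mem h)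
      have hL := run_labDisj _ _ _ o ho hL0
      obtain ⟨hTg, hTd⟩ := run_tidy _ _ _ o ho hL0 (tidy_pristine (rest.min' h)) hE.2.2
      split_ifs at ht with hg
      · rw [Multiset.mem_map] at ht
        obtain ⟨t', ht', rfl⟩ := ht
        have hE' : EnvOK obs legs o.rest o.done := ⟨fun h hh => (hL.2.1 h hh).2, hL.2.2, hTd⟩
        obtain ⟨h1, h2⟩ := expand_tidy n o.done o.rest hcard hE' t' ht'
        refine ⟨fun g hg' => ?_, h2⟩
        simp only [WTerm.addConst_consts, oact_consts, Multiset.mem_cons] at hg'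
        rcases hg' with rfl | hg'
        · exact hTg
        · exact h1 g hg'
      · rw [Multiset.mem_map] at ht
        obtain ⟨t', ht', rfl⟩ := ht
        obtain ⟨h1, h2⟩ := expand_tidy n _ o.rest hcard (envOK_cons hL hTg hTd) t' ht'
        exact ⟨h1, h2⟩
    · rw [expand_of_not_nonempty Cov trig f c legs obs M h, Multiset.mem_singleton] at ht
      subst ht
      exact ⟨fun g hg => absurd hg (Multiset.notMem_zero _), hE.2.2⟩

/-- **The printed currency of a component**: a large constant per observable it contains times a small factor per
cube of its `X` not covered by its observables, `(Π_{j ∈ X.lab} B_ℓ^{|obs j|}) · θ^{#(cubes X ∖ ⋃_{j∈X.lab} oc j)}`.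
[cite: BalabanImbrieJaffe1988, §5.14 p.312] -/
def shape (obs : κ → List (S → ℝ)) (oc : κ → Finset β) (vc : ι → Finset β) (reg : P → Finset β) (Bl θ : ℝ)
    (g : WGrp S κ ι P) : ℝ :=
  (∏ j ∈ g.lab, Bl ^ (obs j).length) * θ ^ (cubes oc vc reg g \ g.lab.biUnion oc).card

/-- **THE WEIGHT OF EVERY TERM IN THE PRINTED CURRENCY, COMPONENT BY COMPONENT** (p. 312): for the integration by
parts of a product of observables with the covariance split, under the bracket/coupling hypotheses of
`BIJ88WalkWeights312.run_weight` and the currency hypotheses of `wt_le_shape`, every term `t` of `expand 0 K` satisfies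
`|coef_t| · Π_{z ∈ dirs_t}‖z‖ ≤ Π_{X ∈ t.consts} shape X · Π_{X ∈ t.groups} shape X` — each block and each remainder
component carries a large constant per observable it contains and a small factor `θ` per cube of its `X` not covered
by its observables. [cite: BalabanImbrieJaffe1988, §5.14 p.312] -/
theorem expand_shape_init {Dir : Set (S → ℝ)} {oc : κ → Finset β} {vc : ι → Finset β} {reg : P → Finset β}
    {B : P → ℝ} {cV : ι → ℝ} {Bl θ : ℝ} (hθ0 : 0 < θ) (hθ1 : θ ≤ 1) (hBl : 1 ≤ Bl) (hB0 : ∀ p, 0 ≤ B p)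
    (hcV0 : ∀ m, 0 ≤ cV m) (hB : ∀ p, ∀ u ∈ Dir, ∀ w ∈ Dir, |(Cov p *ᵥ u) ⬝ᵥ w| ≤ B p)
    (hBf : ∀ p, ∀ u ∈ Dir, |(Cov p *ᵥ u) ⬝ᵥ f| ≤ B p) (hBz : ∀ p, ∀ u ∈ Dir, ‖Cov p *ᵥ u‖ ≤ B p)
    (hcV : ∀ m, |c m| ≤ cV m) (hobs : ∀ j, ∀ w ∈ obs j, w ∈ Dir) (hlegs : ∀ m, ∀ w ∈ legs m, w ∈ Dir)
    (hloc : ∀ p, trig p = false → B p ≤ Bl ∧ reg p = ∅) (hwalk : ∀ p, trig p = true → B p ≤ θ ^ (reg p).card)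
    (hvert : ∀ m, cV m * Bl ^ (legs m).length ≤ θ ^ (vc m).card) (K : Finset κ) :
    ∀ t ∈ expand Cov trig f c legs obs M 0 K,
      |t.coef| * (t.dirs.map fun z => ‖z‖).prod
        ≤ (t.consts.map (shape obs oc vc reg Bl θ)).prod * (t.groups.map (shape obs oc vc reg Bl θ)).prod := by
  intro t ht
  have hw := expand_weight_init (trig := trig) (M := M) hB0 hcV0 hB hBf hBz hcV hobs hlegs K t ht
  obtain ⟨hTc, hTg⟩ := expand_tidy (Cov := Cov) (trig := trig) (f := f) (c := c) (M := M) _ 0 K (Nat.lt_succ_self _)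
    (envOK_zero K) t ht
  have hwt0 : ∀ g : WGrp S κ ι P, 0 ≤ wt B cV g := fun g =>
    mul_nonneg (Multiset.prod_nonneg fun x hx => by obtain ⟨p, -, rfl⟩ := Multiset.mem_map.1 hx; exact hB0 p)
      (Multiset.prod_nonneg fun x hx => by obtain ⟨m, -, rfl⟩ := Multiset.mem_map.1 hx; exact hcV0 m)
  have hle : ∀ g : WGrp S κ ι P, Tidy obs legs g → wt B cV g ≤ shape obs oc vc reg Bl θ g := fun g hg =>
    wt_le_shape hθ0 hθ1 hBl hB0 hcV0 hloc hwalk hvert g hg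
  have h1 : (t.consts.map (wt B cV)).prod ≤ (t.consts.map (shape obs oc vc reg Bl θ)).prod :=
    Multiset.prod_map_le_prod_map₀ _ _ (fun g _ => hwt0 g) fun g hg => hle g (hTc g hg)
  have h2 : (t.groups.map (wt B cV)).prod ≤ (t.groups.map (shape obs oc vc reg Bl θ)).prod :=
    Multiset.prod_map_le_prod_map₀ _ _ (fun g _ => hwt0 g) fun g hg => hle g (hTg g hg)
  have h10 : 0 ≤ (t.consts.map (wt B cV)).prod :=
    Multiset.prod_nonneg fun x hx => by obtain ⟨g, -, rfl⟩ := Multiset.mem_map.1 hx; exact hwt0 g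
  have h20 : 0 ≤ (t.groups.map (shape obs oc vc reg Bl θ)).prod :=
    Multiset.prod_nonneg fun x hx => by
      obtain ⟨g, -, rfl⟩ := Multiset.mem_map.1 hx
      exact mul_nonneg (Finset.prod_nonneg fun j _ => pow_nonneg (zero_le_one.trans hBl) _) (pow_nonneg hθ0.le _)
  exact hw.trans (mul_le_mul h1 h2 (le_trans (Multiset.prod_nonneg fun x hx => by
    obtain ⟨g, -, rfl⟩ := Multiset.mem_map.1 hx; exact hwt0 g) le_rfl) (h10.trans h1))

end Expand

end Literature.MathematicalPhysics.QuantumFieldTheory.BalabanImbrieJaffe1984to88.BIJ88WalkActivityShape312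

end
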